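import Summits.CriticalPhenomena.PercolationContinuityZ3.Theorems.PercNearOneGluingNoHeavyPcintVdBEProcess
import HarnessLib

/-!
# PCINT lane, king route, K1 step (2L′): the `ξ`-process with the root rule `ε(o) = (1,1)`

Cell `prim-pcint`, seat `prim-pcint-1` (gen 9); memo `run/shared/lean/prim/pcint/KING-ROUTE.md` §K1 (status at gen-9
close, option (c)).

Variant of `VdBEProcess.outVdBE` (`…PcintVdBEProcess.lean`) in which the root is declared good only when BOTH sites
of its pair are open (`w o = (true, true)`).  With this rule the first generation of children of `o` has the PRODUCT
law `⊗_a Bern(1 - (1-p)²)` (every child of `o` is `ε`-adjacent to `o` iff its own pair has an open site), which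
dominates `π_q^{⊗4}` coordinatewise (`VdBELocal.origin_marginal_ge`), and the later steps use the root families
`VdBELocal.checkRoot11_of_mem`; the root step itself is absorbed in the constant `q / p²`.

* `VdBEProcess11.outVdBE11`, `etaChain_of_run_eq_some_true`, `exists_pathIn_star_of_run_eq_some_true`,
  `exists_pathIn_star_of_reach` — as in `VdBEProcess`, with `w o = (true, true)` in place of `w o ≠ (false, false)`.
-/

noncomputable section

namespace Summit.CriticalPhenomena.PercolationContinuityZ3.Theorems.Pcint

namespace VdBEProcess11

open Finset AdaptDom ClusterExpl KingPairs VdBEProcess Literature.Probability.Percolation Literature.Probability.LatticeModels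

variable (Λ : Finset (Site 2)) (enc : ↥Λ → ℕ) (o : ↥Λ)

open Classical in
/-- **The oracle with the root rule `ε(o) = (1,1)`**: at the root step report `[w o = (1,1)]`; afterwards report
whether the examined site is `ε`-adjacent (in `cfg w`) to the selected site. -/
def outVdBE11 (w : ↥Λ → Bool × Bool) (σ : ↥Λ → Option Bool) (a : ↥Λ) : Bool :=
  if ∀ v, σ v = none then decide (w a = (true, true))
  else match sel (boxGraph Λ) enc σ with
    | none => false
    | some b => decide (EtaAdj (cfg Λ w) a.1 b.1)

variable {Λ enc o}

/-- **Every site revealed true is `ε`-chained to the root** (root rule `ε(o) = (1,1)`): along the run, if `v` is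
revealed true after `n` steps then `w o = (1,1)` and `v` is joined to `o` by a chain of `ε`-adjacent sites of `Λ`. -/
theorem etaChain_of_run_eq_some_true (w : ↥Λ → Bool × Bool) :
    ∀ (n : ℕ) (v : ↥Λ), run (rule (boxGraph Λ) enc o) (outVdBE11 Λ enc w) n v = some true →
      w o = (true, true) ∧ Relation.ReflTransGen (fun a b : ↥Λ => EtaAdj (cfg Λ w) a.1 b.1) o v
  | 0, v, hv => by simp [run] at hv
  | n + 1, v, hv => by
    set τ := run (rule (boxGraph Λ) enc o) (outVdBE11 Λ enc w) n with hτ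
    change stepPA (rule (boxGraph Λ) enc o τ) τ (outVdBE11 Λ enc w τ) v = some true at hv
    unfold stepPA at hv
    by_cases hvR : v ∈ rule (boxGraph Λ) enc o τ
    · rw [if_pos hvR, Option.some.injEq] at hv
      unfold outVdBE11 at hv
      by_cases hinit : ∀ u, τ u = none
      · rw [if_pos hinit, decide_eq_true_eq] at hv
        have hR : rule (boxGraph Λ) enc o τ = {o} := by rw [rule, if_pos hinit]
        rw [hR, mem_singleton] at hvR
        subst hvR
        exact ⟨hv, Relation.ReflTransGen.refl⟩
      · rw [if_neg hinit] at hv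
        cases hsel : sel (boxGraph Λ) enc τ with
        | none => rw [hsel] at hv; simp at hv
        | some b =>
          rw [hsel] at hv
          simp only [decide_eq_true_eq] at hv
          have hb : τ b = some true := (mem_filter.1 (sel_spec (boxGraph Λ) enc hsel).1).2.1
          obtain ⟨ho, hchain⟩ := etaChain_of_run_eq_some_true w n b hb
          exact ⟨ho, hchain.tail (etaAdj_comm.1 hv)⟩
    · rw [if_neg hvR] at hv
      exact etaChain_of_run_eq_some_true w n v hv

/-- **Sites revealed true are reached by open `∗`-paths from BOTH sites of the pair of the root** (root rule
`ε(o) = (1,1)`). -/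
theorem exists_pathIn_star_of_run_eq_some_true (w : ↥Λ → Bool × Bool) {n : ℕ} {v : ↥Λ}
    (hv : run (rule (boxGraph Λ) enc o) (outVdBE11 Λ enc w) n v = some true) (i : Bool) :
    ∃ j : Bool, pairSite o.1 i ∈ cfg Λ w ∧ pairSite v.1 j ∈ cfg Λ w ∧
      PathIn zdStarGraph (cfg Λ w) (pairSite o.1 i) (pairSite v.1 j) := by
  obtain ⟨ho, hchain⟩ := etaChain_of_run_eq_some_true w n v hv
  have hi : pairSite o.1 i ∈ cfg Λ w := by
    cases i
    · exact pairSite_false_mem_cfg.2 (by rw [ho])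
    · exact pairSite_true_mem_cfg.2 (by rw [ho])
  have hj : ∃ j : Bool, pairSite v.1 j ∈ cfg Λ w := by
    rcases Relation.ReflTransGen.cases_tail hchain with h | ⟨b, -, hbv⟩
    · subst h; exact ⟨i, hi⟩
    · exact exists_pairSite_mem_of_etaAdj hbv
  obtain ⟨j, hj⟩ := hj
  exact ⟨j, hi, hj, pathIn_star_of_etaChain hchain i j hi hj⟩

/-- **If the payoff of the final state is `1`, an open `∗`-path joins the bottom site of the pair of the root to the
pair of a target site** (root rule `ε(o) = (1,1)`). -/
theorem exists_pathIn_star_of_reach (w : ↥Λ → Bool × Bool) (B : Finset ↥Λ) (ω₀ : ↥Λ → Bool)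
    (h : reachIndicator (boxGraph Λ) o B
      (merge (run (rule (boxGraph Λ) enc o) (outVdBE11 Λ enc w) (Fintype.card ↥Λ + 1)) ω₀) = 1) :
    ∃ v ∈ B, ∃ j : Bool, pairSite v.1 j ∈ cfg Λ w ∧
      PathIn zdStarGraph (cfg Λ w) (pairSite o.1 false) (pairSite v.1 j) := by
  set σ := run (rule (boxGraph Λ) enc o) (outVdBE11 Λ enc w) (Fintype.card ↥Λ + 1) with hσ
  have hex : ∃ v ∈ B, OpenPath (boxGraph Λ) o (merge σ ω₀) v := by
    by_contra hne
    unfold reachIndicator at h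
    rw [if_neg hne] at h
    exact zero_ne_one h
  obtain ⟨v, hvB, hp⟩ := hex
  have hterm : rule (boxGraph Λ) enc o σ = ∅ := rule_run_card_succ (boxGraph Λ) enc o _
  have ho : σ o ≠ none := run_root_ne_none (boxGraph Λ) enc o _ _ (Nat.le_add_left 1 _)
  have hne : ¬ ∀ u, σ u = none := fun hall => ho (hall o)
  have hv : σ v = some true := mem_revealedTrue_of_openPath (boxGraph Λ) enc o hne hterm ho hp
  obtain ⟨j, -, hj, hpath⟩ := exists_pathIn_star_of_run_eq_some_true (o := o) w hv false
  exact ⟨v, hvB, j, hj, hpath⟩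

end VdBEProcess11

end Summit.CriticalPhenomena.PercolationContinuityZ3.Theorems.Pcint

end
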